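import Mathlib
import Summits.QuantumFields.YangMills.Theorems.BalabanUVNodesN15DerivDefectLattices
import HarnessLib

/-!
# Route «BalabanUVNodes» (cluster K4 «SpineRates»), Track-A DAG node N15 = spine estimate NE2, BACKGROUND LAYER — FIRST MISSING
# ESTIMATE, part 12a: THE BLOCK MEAN ON `ℤ^d` (linearised background transport), THE WINDOW IDENTITY
# `∇^η(block mean) = window mean of ∇^{η′}`, AND (R3)-LINEARISED: the block mean of a (3.35)∕(3.36)-regular fine field is
# (3.35)∕(3.36)-regular on the coarse lattice with the SAME letters; species S0 (the field against its block mean) on the infinite lattice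

Cell `pub-ymgap`, seat `pub-ymgap-dag-n15-b` (generation g2; FIRST-MISSING-ESTIMATE, HUMAN RULING D-0062; chair R424 venue; ROSTER-D0062
l.26 «-b: background-layer estimate»).  `bears_on: R4∕N15`.  Filed `--supports stmt-QuantumFields-19351` (spine leaf `BalabanLadder.UV`).
Predecessors BY NAME: g0's `BalabanUVNodesN15DerivDefect*` ∕ `…FirstOrderDefect` ∕ `…BackgroundStep` (the background step
`idef_background_propagator_majorant` and its binder map, memo `HOME/pub-ymgap-dag-n15-b/N15B-BACKGROUND-LAYER.md` v0.4 §2b), and the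
lineage's `T4EtaRateCoeffDefect` (p193236: the coefficient fit for FINITE fibres, `blockAvg` ∕ `fit_blockAvg`).

WHERE THIS SITS (three-file module 12a∕12b∕12c «the coefficient species of V′₁(A)»).  The g0 background step reduces NE2⁺-LOCAL to six
binders (memo §2): (a) NE2⁰ (the -a seat), (b)–(d2) one-run letters of the printed shapes (3.42)∕(3.63) — in-edge N06's currency —, (f)
automatic, and (e)∕(d3) THE COEFFICIENT FIT `hfit : ∀ x′, |a′ x′ − a (π x′)| ≤ o (blk (π x′))` consumed by `N15.DerivDefect.hasMaj_coeffPiece`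
(first-order term) and `hasMaj_comp_idef_zerothOrder_comp` (zeroth-order terms).  The first-order operator of
[Balaban1985BackgroundPropagators] (3.50)–(3.52) p. 400 (verbatim, first-hand from the held text `paper:balaban1985-cmp99-background-propagators`):
*«(V′₁(A)λ)(x) = Σ_{b∈st(x)} i[A′(b), (D^η_U λ)(b)] + i[(D^{η*}_U A)(x), λ(x)] + Σ_{b∈st(x)} F′_{1,k}(i ad_{A′(b)}) λ(b₊)»*, with (3.50)
*«η^{−2}(2dλ(x) − Σ_{b∈st(x)} exp(iη ad_{A′(b)}) R(U_b)λ(b₊))»*, carries FOUR coefficient species: (S0) the field `A′(b)` itself — the only one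
whose fit was a tree theorem (`T4EtaRateCoeffDefect`, finite fibres) —, (S1) maps NONLINEAR in `A(b)` with the spacing `η` INSIDE
(`η⁻¹(e^{iη ad A} − 1)`, `F′_{1,k}`; file 12c `…N15NonlinearCoefficient`), (S2) lattice DERIVATIVES of the field (the divergence `D^{η*}_U A`;
file 12b `…N15DerivCoefficient`).  THIS FILE is the common base: the block mean on the infinite lattice `ℤ^d` with the prelude's blocks
(`QuantumLattice.blockMap ∕ blockBase ∕ blockSites`), the exact WINDOW IDENTITY behind species S2 and behind the record's remark (R3)
(`t4/T4-EST-U1a.md` §1.5, verbatim: *«(3.35) for U′ ⇒ (3.35) for Ū′ⁿ with another O(1) … an averaged version is NOT PRINTED as such … it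
belongs to sub-estimate NE2-LOCAL-A»*) — here PROVED for the linear transport with `O(1) = 1`, at the orders of (3.35) AND (3.36).

THE PRINT USED (SHAPES only; nothing of [B9] asserted): (3.35) p. 396 *«|A| < O(1)Mα₀(L^jη)^{−1}, |∇^ηA| < O(1)Mα₀(L^jη)^{−2} on □»*;
(3.36) p. 396 *«|∂^{η*}∂^ηA| < O(1)Mα₀(L^jη)^{−3} on □»*; (3.50)–(3.52) p. 400 as quoted (MECHANISM: why these coefficients occur).

CONTENTS (all [folklore]: finite averages and lattice combinatorics on `ℤ^d`).
* §1 Averages: `abs_sub_avg_le`, `abs_avg_le`.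
* §2 `offs d M = {0,…,M−1}^d`, `bpt M y t = M·y + t`, `blockMean M a′ y` (= the mean over the prelude's `blockSites M y`:
  `blockMean_eq_blockSites`), `lineAvg M μ g` (mean over `M` consecutive sites along `μ`); `blockMap_bpt`, `bpt_succ`, `blockMean_succ`;
  THE WINDOW IDENTITY `fdiff_blockMean` ∕ `fdiffN_blockMean` (`Mη′ = η`): `∇^η_μ(blockMean a′) = blockMean (lineAvg_μ (∇^{η′}_μ a′))`;
  `fdiffN_lineAvg_comm`; `blockMean_lineAvg_eq_avg` (the window mean as ONE mean over block × positions).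
* §3 (R3)-LINEARISED: `abs_blockMean_le` (sup letter), `abs_fdiffN_blockMean_le` (gradient letter, (3.35) shape), `abs_fdiffN_fdiffN_blockMean_le`
  (second differences, (3.36) shape): a bound on the fine quantity on the window gives the SAME bound on the coarse quantity of the block mean.
* §4 SPECIES S0 on `ℤ^d` (no `Fintype`): `fit_blockMean` — `|a′(x′) − blockMean a′(⌊x′∕M⌋)| ≤ d(M−1)·θ₁(⌊x′∕M⌋)` from the located per-bond
  letter `T4EtaRateCoeffDefect.InBlockBondBound M a′ θ₁` and its `osc_of_inBlockBondBound` (BY NAME); `fit_blockMean_rate` (`θ₁ = η′G₁`,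
  `Mη′ = η` ⟹ `≤ d·η·G₁`, `coeff_osc_rate` BY NAME).
* §5 PLUG: `hfit_of_pointwise` — a pointwise `ℤ^d` fit indexed by the coarse site gives, on finite windows (`T4EtaRateCoeffDefect.blockProj`)
  and under a cube-wise domination, the `hfit` binder of `hasMaj_coeffPiece` ∕ `hasMaj_comp_idef_zerothOrder_comp` verbatim; `zdLine_shifts`
  (the shifts of `N15.DerivDefect.zdLine` ARE the unit translations used here, by `rfl`).

HONEST FRAMING ∕ LIMITS.  MECHANISM over hypothesis-SHAPED letters: real scalar fields; the LINEARISED transport (block mean) — Bałaban's (C3)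
transport is the nonlinear n-fold average, whose fit letter is NE3's currency (memo §2 (e)); flat differences; `ℤ^d` (torus ∕ `LineData` transfer =
g0 residue (ii)); no instance against [B6]∕[B9]'s actual expansions.  NE2⁺ NOT PRINTED, NOT proved; count-neutral (typed 28∕28; nothing
discharged); one finite T⁴ at fixed ε — NOT infinite volume, NOT OS on ℝ⁴, NOT a mass gap, NOT Clay.
-/

noncomputable section

namespace Summit.QuantumFields.YangMills.BalabanUVNodes.N15.CoefficientSpecies

open Literature.MathematicalPhysics.QuantumFieldTheory.Balaban1983to89
open Literature.MathematicalPhysics.QuantumFieldTheory.Balaban1983to89.T4EtaRateCoeffDefect (InBlockBondBound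
  osc_of_inBlockBondBound coeff_osc_rate blockProj blockProj_val)
open Literature.MathematicalPhysics.QuantumLattice (blockMap blockBase blockSites)
open Literature.Probability.LatticeModels (Site)
open Summit.QuantumFields.YangMills.BalabanUVNodes.N15.DerivDefect (fdiff fdiffN bdiffN fdiff_apply fdiffN_apply bdiffN_apply
  zdLine)

variable {d : ℕ}

/-! ## §1 Averages -/

section Avg

variable {ι : Type*}

/-- A number within `B` of every member of a finite nonempty family is within `B` of the family's MEAN. [folklore] -/
theorem abs_sub_avg_le {S : Finset ι} (hS : S.Nonempty) (g : ι → ℝ) {a B : ℝ} (h : ∀ w ∈ S, |a - g w| ≤ B) :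
    |a - (∑ w ∈ S, g w) / S.card| ≤ B := by
  have hcard : (0 : ℝ) < S.card := by exact_mod_cast hS.card_pos
  have hrepr : a - (∑ w ∈ S, g w) / S.card = (∑ w ∈ S, (a - g w)) / S.card := by
    rw [Finset.sum_sub_distrib, Finset.sum_const, nsmul_eq_mul]
    field_simp
  rw [hrepr, abs_div, abs_of_pos hcard, div_le_iff₀ hcard]
  calc |∑ w ∈ S, (a - g w)| ≤ ∑ w ∈ S, |a - g w| := Finset.abs_sum_le_sum_abs _ _
    _ ≤ ∑ _w ∈ S, B := Finset.sum_le_sum h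
    _ = B * S.card := by rw [Finset.sum_const, nsmul_eq_mul, mul_comm]

/-- The mean of a finite nonempty family bounded by `B` is bounded by `B`. [folklore] -/
theorem abs_avg_le {S : Finset ι} (hS : S.Nonempty) (g : ι → ℝ) {B : ℝ} (h : ∀ w ∈ S, |g w| ≤ B) :
    |(∑ w ∈ S, g w) / S.card| ≤ B := by
  have h0 := abs_sub_avg_le hS g (a := 0) (B := B) (fun w hw => by simpa using h w hw)
  simpa using h0

end Avg

/-! ## §2 The block mean on `ℤ^d`, the line average, and the window identity -/

section BlockMean

/-- The block OFFSETS `{0, …, M−1}^d` (the prelude's parametrisation of `blockSites`). [folklore] -/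
def offs (d M : ℕ) : Finset (Fin d → ℕ) := Fintype.piFinset fun _ : Fin d => Finset.range M

/-- Membership in the offsets. [folklore] -/
@[simp] theorem mem_offs {M : ℕ} {t : Fin d → ℕ} : t ∈ offs d M ↔ ∀ i, t i < M := by
  simp [offs, Fintype.mem_piFinset]

/-- `#{0,…,M−1}^d = M^d`. [folklore] -/
theorem card_offs (M : ℕ) : (offs d M).card = M ^ d := by
  rw [offs, Fintype.card_piFinset_const, Finset.card_range]

/-- The offsets are nonempty for `M ≥ 1` (the zero offset). [folklore] -/
theorem offs_nonempty {M : ℕ} (hM : 0 < M) : (offs d M).Nonempty :=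
  ⟨fun _ => 0, mem_offs.2 fun _ => hM⟩

/-- THE BLOCK POINT `M·y + t` of the block labelled `y` at offset `t` (prelude `blockBase M y + t`). [folklore] -/
def bpt (M : ℕ) (y : Site d) (t : Fin d → ℕ) : Site d := blockBase M y + fun i => (t i : ℤ)

/-- Coordinates of a block point. [folklore] -/
@[simp] theorem bpt_apply (M : ℕ) (y : Site d) (t : Fin d → ℕ) (i : Fin d) : bpt M y t i = (M : ℤ) * y i + t i := rfl

/-- A block point lies in its block: `⌊(M·y + t)∕M⌋ = y` for `t ∈ {0,…,M−1}^d` (prelude `blockMap_blockBase_add`). [folklore] -/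
theorem blockMap_bpt (M : ℕ) (y : Site d) {t : Fin d → ℕ} (ht : t ∈ offs d M) : blockMap M (bpt M y t) = y :=
  Literature.MathematicalPhysics.QuantumLattice.blockMap_blockBase_add M y t (mem_offs.1 ht)

/-- `t ↦ M·y + t` is injective. [folklore] -/
theorem bpt_injective (M : ℕ) (y : Site d) : Function.Injective (bpt M y) := by
  intro t t' h
  funext i
  have := congr_fun h i
  simp only [bpt_apply, add_right_inj, Nat.cast_inj] at this
  exact this

/-- The coarse unit shift moves the block by `M` fine units: `M·(y + e_μ) + t = (M·y + t) + M·e_μ`. [folklore] -/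
theorem bpt_succ (M : ℕ) (y : Site d) (t : Fin d → ℕ) (μ : Fin d) :
    bpt M (y + Pi.single μ 1) t = bpt M y t + Pi.single μ (M : ℤ) := by
  funext i
  simp only [bpt_apply, Pi.add_apply]
  by_cases hi : i = μ
  · subst hi
    simp only [Pi.single_eq_same]
    ring
  · simp only [Pi.single_eq_of_ne hi]
    ring

/-- THE BLOCK MEAN of a fine-lattice function over the block of side `M` labelled by a coarse site (the LINEARISED background transport;
`T4EtaRateCoeffDefect.blockAvg` for the infinite lattice `ℤ^d`, where the fibres are the prelude's blocks). [folklore] -/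
def blockMean (M : ℕ) (a' : Site d → ℝ) (y : Site d) : ℝ := (∑ t ∈ offs d M, a' (bpt M y t)) / (M : ℝ) ^ d

/-- DICTIONARY: the block mean is the mean over the prelude's `blockSites M y`. [folklore] -/
theorem blockMean_eq_blockSites (M : ℕ) (a' : Site d → ℝ) (y : Site d) :
    blockMean M a' y = (∑ x ∈ blockSites M y, a' x) / (M : ℝ) ^ d := by
  unfold blockMean
  congr 1
  unfold Literature.MathematicalPhysics.QuantumLattice.blockSites
  rw [Finset.sum_image (g := fun t : Fin d → ℕ => blockBase M y + fun i => (t i : ℤ))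
    (fun t _ t' _ h => bpt_injective M y h)]
  rfl

/-- The block mean as a mean with the cardinality in the denominator. [folklore] -/
theorem blockMean_eq_avg (M : ℕ) (a' : Site d → ℝ) (y : Site d) :
    blockMean M a' y = (∑ t ∈ offs d M, a' (bpt M y t)) / (offs d M).card := by
  rw [blockMean, card_offs]
  push_cast
  rfl

/-- THE LINE AVERAGE over `M` consecutive sites in direction `μ`: `(lineAvg g)(x) = M⁻¹ Σ_{k<M} g(x + k e_μ)`. [folklore] -/
def lineAvg (M : ℕ) (μ : Fin d) (g : Site d → ℝ) (x : Site d) : ℝ :=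
  (∑ k ∈ Finset.range M, g (x + Pi.single μ (k : ℤ))) / (M : ℝ)

/-- The block mean is linear: differences. [folklore] -/
theorem blockMean_sub (M : ℕ) (a b : Site d → ℝ) (y : Site d) :
    blockMean M (fun x => a x - b x) y = blockMean M a y - blockMean M b y := by
  simp only [blockMean, Finset.sum_sub_distrib, sub_div]

/-- The block mean commutes with scalars. [folklore] -/
theorem blockMean_const_mul (M : ℕ) (c : ℝ) (a : Site d → ℝ) (y : Site d) :
    blockMean M (fun x => c * a x) y = c * blockMean M a y := by
  simp only [blockMean, ← Finset.mul_sum, mul_div_assoc]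

/-- SHIFT: the block mean at `y + e_μ` is the block mean at `y` of the fine function shifted by `M` fine units. [folklore] -/
theorem blockMean_succ (M : ℕ) (a' : Site d → ℝ) (y : Site d) (μ : Fin d) :
    blockMean M a' (y + Pi.single μ 1) = blockMean M (fun x => a' (x + Pi.single μ (M : ℤ))) y := by
  simp only [blockMean, bpt_succ]

/-- TELESCOPE along a line: `g(x + M e_μ) − g(x) = Σ_{k<M} (g(x + (k+1)e_μ) − g(x + k e_μ))`. [folklore] -/
theorem sub_eq_sum_fdiff_line (M : ℕ) (μ : Fin d) (g : Site d → ℝ) (x : Site d) :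
    g (x + Pi.single μ (M : ℤ)) - g x =
      ∑ k ∈ Finset.range M, fdiff (fun z => z + Pi.single μ 1) g (x + Pi.single μ (k : ℤ)) := by
  have h := Finset.sum_range_sub (fun k : ℕ => g (x + Pi.single μ (k : ℤ))) M
  simp only [Nat.cast_zero, Pi.single_zero, add_zero] at h
  rw [← h]
  refine Finset.sum_congr rfl fun k _ => ?_
  simp only [fdiff_apply, add_assoc, ← Pi.single_add]
  push_cast
  ring_nf

/-- THE WINDOW IDENTITY (unnormalised): the coarse difference of the block mean is the block mean of the `M`-step fine difference, i.e. of
the SUM of `M` consecutive unit fine differences. [folklore] -/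
theorem fdiff_blockMean (M : ℕ) (a' : Site d → ℝ) (μ : Fin d) (y : Site d) :
    fdiff (fun z => z + Pi.single μ 1) (blockMean M a') y =
      blockMean M (fun x => ∑ k ∈ Finset.range M, fdiff (fun z => z + Pi.single μ 1) a' (x + Pi.single μ (k : ℤ))) y := by
  rw [fdiff_apply, blockMean_succ, ← blockMean_sub]
  simp only [sub_eq_sum_fdiff_line]

/-- Inverse of a product of the two spacings: `η⁻¹ = M⁻¹η′⁻¹` when `Mη′ = η` (no non-vanishing needed). [folklore] -/
theorem inv_eta_eq {M : ℕ} {η η' : ℝ} (hMη : (M : ℝ) * η' = η) : η⁻¹ = (M : ℝ)⁻¹ * η'⁻¹ := by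
  rw [← hMη, mul_inv]

/-- THE WINDOW IDENTITY (normalised, `Mη′ = η`): `∇^η_μ (blockMean a′) = blockMean (lineAvg_μ (∇^{η′}_μ a′))` — the coarse difference
QUOTIENT of the block mean is the mean, over the block and over `M` consecutive positions along `μ`, of the fine difference quotient. [folklore] -/
theorem fdiffN_blockMean {M : ℕ} {η η' : ℝ} (hMη : (M : ℝ) * η' = η) (a' : Site d → ℝ) (μ : Fin d) (y : Site d) :
    fdiffN η (fun z => z + Pi.single μ 1) (blockMean M a') y =
      blockMean M (lineAvg M μ (fdiffN η' (fun z => z + Pi.single μ 1) a')) y := by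
  have key : fdiffN η (fun z => z + Pi.single μ 1) (blockMean M a') y =
      η⁻¹ * fdiff (fun z => z + Pi.single μ 1) (blockMean M a') y := by
    simp only [fdiffN_apply, fdiff_apply]
  rw [key, fdiff_blockMean, ← blockMean_const_mul]
  congr 1
  funext x
  simp only [lineAvg, fdiffN_apply, fdiff_apply, inv_eta_eq hMη, Finset.mul_sum, div_eq_inv_mul]
  refine Finset.sum_congr rfl fun k _ => ?_
  ring

/-- Shifts of `ℤ^d` commute: the fine difference quotient of a line average is the line average of the fine difference quotient. [folklore] -/
theorem fdiffN_lineAvg_comm (M : ℕ) (μ ν : Fin d) (η' : ℝ) (g : Site d → ℝ) (x : Site d) :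
    fdiffN η' (fun z => z + Pi.single ν 1) (lineAvg M μ g) x =
      lineAvg M μ (fdiffN η' (fun z => z + Pi.single ν 1) g) x := by
  simp only [fdiffN_apply, lineAvg]
  rw [← Finset.mul_sum, ← sub_div, ← Finset.sum_sub_distrib, mul_div_assoc]
  congr 2
  refine Finset.sum_congr rfl fun k _ => ?_
  rw [add_right_comm]

/-- The line average as a mean with the cardinality in the denominator. [folklore] -/
theorem lineAvg_eq_avg (M : ℕ) (μ : Fin d) (g : Site d → ℝ) (x : Site d) :
    lineAvg M μ g x = (∑ k ∈ Finset.range M, g (x + Pi.single μ (k : ℤ))) / (Finset.range M).card := by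
  rw [lineAvg, Finset.card_range]

/-- The block mean of a line average is ONE mean over the window `{M·y + t + k e_μ : t ∈ {0..M−1}^d, k < M}` (block × positions). [folklore] -/
theorem blockMean_lineAvg_eq_avg (M : ℕ) (μ : Fin d) (g : Site d → ℝ) (y : Site d) :
    blockMean M (lineAvg M μ g) y =
      (∑ p ∈ offs d M ×ˢ Finset.range M, g (bpt M y p.1 + Pi.single μ (p.2 : ℤ))) / (offs d M ×ˢ Finset.range M).card := by
  rw [Finset.card_product, card_offs, Finset.card_range, Finset.sum_product, blockMean]
  simp only [lineAvg, Finset.sum_div]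
  push_cast
  refine Finset.sum_congr rfl fun t _ => Finset.sum_congr rfl fun k _ => ?_
  rw [div_div]
  ring

end BlockMean

/-! ## §3 (R3) linearised: the block mean of a (3.35)∕(3.36)-regular fine field is (3.35)∕(3.36)-regular with the same letters -/

section Regularity

/-- SUP LETTER: `|a′| ≤ C` on the block ⟹ `|blockMean a′(y)| ≤ C`. [folklore] -/
theorem abs_blockMean_le {M : ℕ} (hM : 0 < M) {a' : Site d → ℝ} {y : Site d} {C : ℝ}
    (h : ∀ t ∈ offs d M, |a' (bpt M y t)| ≤ C) : |blockMean M a' y| ≤ C := by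
  rw [blockMean_eq_avg]
  exact abs_avg_le (offs_nonempty hM) _ h

/-- A line average of a function bounded on the line is bounded by the same constant. [folklore] -/
theorem abs_lineAvg_le {M : ℕ} (hM : 0 < M) {μ : Fin d} {g : Site d → ℝ} {x : Site d} {C : ℝ}
    (h : ∀ k < M, |g (x + Pi.single μ (k : ℤ))| ≤ C) : |lineAvg M μ g x| ≤ C := by
  rw [lineAvg_eq_avg]
  exact abs_avg_le ⟨0, Finset.mem_range.2 hM⟩ _ fun k hk => h k (Finset.mem_range.1 hk)

/-- GRADIENT LETTER ((3.35) shape): a bound `G` on the fine difference quotient `∇^{η′}_μ a′` on the window `{M·y + t + k e_μ}` gives the SAME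
bound on the coarse difference quotient of the block mean at `y` (`Mη′ = η`). [folklore] -/
theorem abs_fdiffN_blockMean_le {M : ℕ} (hM : 0 < M) {η η' : ℝ} (hMη : (M : ℝ) * η' = η) {a' : Site d → ℝ} (μ : Fin d)
    {y : Site d} {G : ℝ}
    (h : ∀ t ∈ offs d M, ∀ k < M, |fdiffN η' (fun z => z + Pi.single μ 1) a' (bpt M y t + Pi.single μ (k : ℤ))| ≤ G) :
    |fdiffN η (fun z => z + Pi.single μ 1) (blockMean M a') y| ≤ G := by
  rw [fdiffN_blockMean hMη]
  exact abs_blockMean_le hM fun t ht => abs_lineAvg_le hM fun k hk => h t ht k hk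

/-- SECOND-DIFFERENCE LETTER ((3.36) shape): a bound `G₂` on `∇^{η′}_ν∇^{η′}_μ a′` on the window `{M·y + t + k e_μ + l e_ν}` gives the SAME
bound on `∇^η_ν∇^η_μ (blockMean a′)` at `y`. [folklore] -/
theorem abs_fdiffN_fdiffN_blockMean_le {M : ℕ} (hM : 0 < M) {η η' : ℝ} (hMη : (M : ℝ) * η' = η) {a' : Site d → ℝ}
    (μ ν : Fin d) {y : Site d} {G₂ : ℝ}
    (h : ∀ t ∈ offs d M, ∀ l < M, ∀ k < M,
      |fdiffN η' (fun z => z + Pi.single ν 1) (fdiffN η' (fun z => z + Pi.single μ 1) a')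
        (bpt M y t + Pi.single ν (l : ℤ) + Pi.single μ (k : ℤ))| ≤ G₂) :
    |fdiffN η (fun z => z + Pi.single ν 1) (fdiffN η (fun z => z + Pi.single μ 1) (blockMean M a')) y| ≤ G₂ := by
  have hfun : fdiffN η (fun z => z + Pi.single μ 1) (blockMean M a') =
      blockMean M (lineAvg M μ (fdiffN η' (fun z => z + Pi.single μ 1) a')) :=
    funext fun y => fdiffN_blockMean hMη a' μ y
  rw [hfun, fdiffN_blockMean hMη]
  refine abs_blockMean_le hM fun t ht => abs_lineAvg_le hM fun l hl => ?_
  rw [fdiffN_lineAvg_comm]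
  exact abs_lineAvg_le hM fun k hk => h t ht l hl k hk

end Regularity

/-! ## §4 Species S0 on `ℤ^d`: the field against its block mean -/

section Species0

/-- SPECIES S0 (the field itself, [B9] (3.52) first summand's coefficient `A′(b)`): from the located per-bond letter
`InBlockBondBound M a′ θ₁` (bonds inside blocks, `θ₁ ≥ 0`), `|a′(x′) − blockMean a′ (⌊x′∕M⌋)| ≤ d(M−1)·θ₁(⌊x′∕M⌋)`. [folklore] -/
theorem fit_blockMean {M : ℕ} (hM : 0 < M) {a' : Site d → ℝ} {θ₁ : Site d → ℝ} (hθ : ∀ y, 0 ≤ θ₁ y)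
    (h : InBlockBondBound M a' θ₁) (x' : Site d) :
    |a' x' - blockMean M a' (blockMap M x')| ≤ (d : ℝ) * ((M : ℝ) - 1) * θ₁ (blockMap M x') := by
  rw [blockMean_eq_avg]
  refine abs_sub_avg_le (offs_nonempty hM) _ fun t ht => ?_
  have hx : blockMap M (bpt M (blockMap M x') t) = blockMap M x' := blockMap_bpt M _ ht
  have := osc_of_inBlockBondBound hM hθ h hx
  rwa [hx] at this

/-- With the (3.35)-shaped per-bond letter `θ₁ = η′G₁` and `Mη′ = η`: `d(M−1)θ₁ ≤ d·η·G₁` (`T4EtaRateCoeffDefect.coeff_osc_rate` BY NAME). [folklore] -/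
theorem fit_blockMean_rate {M : ℕ} (hM : 0 < M) {η η' G₁ : ℝ} (hη' : 0 ≤ η') (hG₁ : 0 ≤ G₁) (hMη : (M : ℝ) * η' = η)
    {a' : Site d → ℝ} (h : InBlockBondBound M a' fun _ => η' * G₁) (x' : Site d) :
    |a' x' - blockMean M a' (blockMap M x')| ≤ (d : ℝ) * η * G₁ :=
  (fit_blockMean hM (fun _ => mul_nonneg hη' hG₁) h x').trans (coeff_osc_rate d M hη' hG₁ rfl hMη)

end Species0

/-! ## §5 Plug: pointwise `ℤ^d` fits give the cube-indexed `hfit` binder of the first-order defect theorems -/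

section Plug

/-- FROM POINTWISE TO THE CONSUMER's BINDER.  A pointwise fit on `ℤ^d` indexed by the coarse site, `|c′(x′) − c(⌊x′∕M⌋)| ≤ o₀(⌊x′∕M⌋)`,
restricted to finite windows `Ω′ → Ω` (`T4EtaRateCoeffDefect.blockProj`) and dominated cube-wise (`o₀(y) ≤ o(blk y)`), IS the binder
`hfit : ∀ x′, |a′ x′ − a (π x′)| ≤ o (blk (π x′))` of `N15.DerivDefect.hasMaj_coeffPiece` ∕ `hasMaj_comp_idef_zerothOrder_comp` with
`π = blockProj M Ω′ Ω`. [folklore] -/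
theorem hfit_of_pointwise {g : B6.Geometry} {M : ℕ} {c' c : Site d → ℝ} {o₀ : Site d → ℝ}
    (hpt : ∀ x', |c' x' - c (blockMap M x')| ≤ o₀ (blockMap M x')) (Ω' Ω : Finset (Site d))
    (hΩ : ∀ x ∈ Ω', blockMap M x ∈ Ω) (blk : {y // y ∈ Ω} → g.Site) {o : g.Site → ℝ}
    (hdom : ∀ y : {y // y ∈ Ω}, o₀ y.1 ≤ o (blk y)) :
    ∀ x' : {x // x ∈ Ω'}, |(fun x : {x // x ∈ Ω'} => c' x.1) x' - (fun y : {y // y ∈ Ω} => c y.1) (blockProj M Ω' Ω hΩ x')|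
      ≤ o (blk (blockProj M Ω' Ω hΩ x')) :=
  fun x' => (hpt x'.1).trans (hdom (blockProj M Ω' Ω hΩ x'))

/-- DICTIONARY to the lineage's line data: the shifts of `N15.DerivDefect.zdLine M hM μ` ARE the unit translations used above (so the species
theorems apply verbatim to `fdiffN η (zdLine M hM μ).s`, `fdiffN η′ (zdLine M hM μ).s′`, `bdiffN η′ (zdLine M hM μ).s′`). [folklore] -/
theorem zdLine_shifts (M : ℕ) (hM : 0 < M) (μ : Fin d) :
    (zdLine M hM μ).s = (fun w : Site d => w + Pi.single μ 1) ∧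
      ((zdLine M hM μ).s' : Site d → Site d) = (fun w : Site d => w + Pi.single μ 1) ∧
      (zdLine M hM μ).s' = Equiv.addRight (Pi.single μ (1 : ℤ)) ∧ (zdLine M hM μ).π = blockMap M :=
  ⟨rfl, rfl, rfl, rfl⟩

end Plug

end Summit.QuantumFields.YangMills.BalabanUVNodes.N15.CoefficientSpecies
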